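import Literature.Analysis.FluidPDE.LagrangianLatticeCarrierFrame
import Literature.Analysis.FluidPDE.PassiveVectorTensorDistortedFrameTest
import HarnessLib

/-!
# The time-clamped frame of a Lagrangian lattice carrier on a refresh window: a globally defined,
# everywhere invertible frame with the regularity the distorted weak class asks of its tests

Analysis/FluidPDE proof file (theorems only; no definitions, no named facts). On the refresh window of
level `m+1` with left end `w = j · refresh (m+1)` and `0 < T < refresh (m+1)`, CLAMP the window time:
`clamp t := max 0 (min t T)`, and read the Jacobian `J̃(t, y) := ∇X_m(w + clamp t, w)(y)` of the coarse
flow (entries `(flowDeriv m (w + clamp t) w y e_c)_a`) and its adjugate `G̃ := adj J̃` for ALL real `t`.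
From `LevelRegular` + `IsFlow m` alone (files `LagrangianLatticeCarrierFrame`, `TorusFlowFrame*`,
`PassiveVectorTensorDistortedFrameTest`):
* `det J̃(t,y) = 1`, `G̃ J̃ = J̃ G̃ = 1` for EVERY `t` (`det_clampFrame_eq_one`, `adjugate_mul_clampFrame`,
  `clampFrame_mul_adjugate`) — the hypothesis `hGJ : ∀ t y, G t y * J t y = 1` of
  `…FramePairing.ae_integral_inner_distort_frame_eq` for the pair `(G̃, J̃)`;
* smooth entries for every `t`, ALL iterated space derivatives of the entries jointly continuous on
  `ℝ × T³` (`continuous_uncurry_iterPartialDeriv_clampFrame_entry`) — the global-in-time test clauses;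
* entrywise Lipschitz and bounded on `[0,T]` (`exists_lipschitz_clampFrame_entry`,
  `exists_bound_clampFrame_entry`) — the inputs of `exists_lipschitz_distort` (FT3);
* the variational equation as a two-sided `HasDerivAt` at every interior time, matrix-valued
  (`hasDerivAt_clampFrame`) — the input `hJ'` (a.e. `t ∈ (0,T)`).
This is the (δ) «clamp both frame fields» packaging: no class change and no backward-in-time bounds.

## References

* S. Armstrong, V. Vicol, *Anomalous diffusion by fractal homogenization*, Ann. PDE 11 (2025),
  arXiv:2305.05048, §2.2 (flows renewed on refresh windows), §4.1 (Lagrangian coordinates). [`ArmstrongVicol2025`]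
* R. J. DiPerna, P.-L. Lions, Invent. Math. 98 (1989), §II.1 (admissible test functions). [`DiPernaLions1989Invent`]
-/

noncomputable section

open Set Filter Topology Function MeasureTheory
open scoped NNReal

namespace Literature.Analysis.FluidPDE.LatticeShear

namespace LagrangianLatticeCarrier

open Literature.Analysis.FunctionSpaces Literature.Analysis.FunctionSpaces.Torus
open Literature.Analysis.ODE.TorusFlow Literature.Analysis.FluidPDE.Torus

variable {k : ℕ} {E : LagrangianLatticeCarrier k}

/-- The clamped time lies in the window. [folklore] -/
private theorem clamp_mem_Icc {T : ℝ} (hT : 0 ≤ T) (t : ℝ) : max 0 (min t T) ∈ Icc 0 T :=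
  ⟨le_max_left _ _, max_le hT (min_le_right _ _)⟩

/-- On the window the clamp is the identity. [folklore] -/
private theorem clamp_eq_self {T t : ℝ} (ht : t ∈ Icc 0 T) : max 0 (min t T) = t := by
  rw [min_eq_left ht.2, max_eq_right ht.1]

/-- **`det J̃ = 1` for every real time.** [cite: ArmstrongVicol2025, §2.2 (volume-preserving flows X_m)] -/
theorem LevelRegular.det_clampFrame_eq_one (h : E.LevelRegular) {m : ℕ} (hF : E.IsFlow m) (j : ℤ)
    {T : ℝ} (hT0 : 0 ≤ T) (hT : T < E.refresh (m + 1)) (t : ℝ) (y : UnitAddTorus (Fin 3)) :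
    (Matrix.of fun a c => (E.flowDeriv m ((j : ℝ) * E.refresh (m + 1) + max 0 (min t T)) ((j : ℝ) * E.refresh (m + 1)) y
      (EuclideanSpace.single c (1 : ℝ))) a).det = 1 :=
  h.det_flowDeriv_eq_one hF j hT (clamp_mem_Icc hT0 t) y

/-- **`G̃ J̃ = 1` for every real time** (`G̃ = adj J̃`). [cite: ArmstrongVicol2025, §4.1 (the distortion ∇X⁻¹)] -/
theorem LevelRegular.adjugate_mul_clampFrame (h : E.LevelRegular) {m : ℕ} (hF : E.IsFlow m) (j : ℤ)
    {T : ℝ} (hT0 : 0 ≤ T) (hT : T < E.refresh (m + 1)) (t : ℝ) (y : UnitAddTorus (Fin 3)) :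
    (Matrix.of fun a c => (E.flowDeriv m ((j : ℝ) * E.refresh (m + 1) + max 0 (min t T)) ((j : ℝ) * E.refresh (m + 1)) y
      (EuclideanSpace.single c (1 : ℝ))) a).adjugate *
    (Matrix.of fun a c => (E.flowDeriv m ((j : ℝ) * E.refresh (m + 1) + max 0 (min t T)) ((j : ℝ) * E.refresh (m + 1)) y
      (EuclideanSpace.single c (1 : ℝ))) a) = 1 := by
  rw [Matrix.adjugate_mul, h.det_clampFrame_eq_one hF j hT0 hT t y, one_smul]

/-- **`J̃ G̃ = 1` for every real time.** [cite: ArmstrongVicol2025, §4.1 (the distortion ∇X⁻¹)] -/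
theorem LevelRegular.clampFrame_mul_adjugate (h : E.LevelRegular) {m : ℕ} (hF : E.IsFlow m) (j : ℤ)
    {T : ℝ} (hT0 : 0 ≤ T) (hT : T < E.refresh (m + 1)) (t : ℝ) (y : UnitAddTorus (Fin 3)) :
    (Matrix.of fun a c => (E.flowDeriv m ((j : ℝ) * E.refresh (m + 1) + max 0 (min t T)) ((j : ℝ) * E.refresh (m + 1)) y
      (EuclideanSpace.single c (1 : ℝ))) a) *
    (Matrix.of fun a c => (E.flowDeriv m ((j : ℝ) * E.refresh (m + 1) + max 0 (min t T)) ((j : ℝ) * E.refresh (m + 1)) y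
      (EuclideanSpace.single c (1 : ℝ))) a).adjugate = 1 := by
  rw [Matrix.mul_adjugate, h.det_clampFrame_eq_one hF j hT0 hT t y, one_smul]

/-- **Smooth entries for every real time.** [cite: ArmstrongVicol2025, §2.2 (smooth flows X_m)] -/
theorem LevelRegular.isSmooth_clampFrame_entry (h : E.LevelRegular) (m : ℕ) (j : ℤ) (T t : ℝ) (a c : Fin 3) :
    IsSmooth (fun y => (Matrix.of fun a c => (E.flowDeriv m ((j : ℝ) * E.refresh (m + 1) + max 0 (min t T))
      ((j : ℝ) * E.refresh (m + 1)) y (EuclideanSpace.single c (1 : ℝ))) a) a c) := by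
  simp only [Matrix.of_apply]
  exact h.isSmooth_flowDeriv_entry m j _ a c

/-- **ALL iterated space derivatives of the clamped entries are jointly continuous on `ℝ × T³`** (the
global-in-time clause of the distorted weak class tests). [cite: DiPernaLions1989Invent, §II.1 (time cut-off of test functions)] -/
theorem LevelRegular.continuous_uncurry_iterPartialDeriv_clampFrame_entry (h : E.LevelRegular) (m : ℕ) (j : ℤ)
    {T : ℝ} (hT0 : 0 ≤ T) (hT : T < E.refresh (m + 1)) (l : List (Fin 3)) (a c : Fin 3) :
    Continuous (uncurry fun t y => iterPartialDeriv l (fun y => (Matrix.of fun a c =>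
      (E.flowDeriv m ((j : ℝ) * E.refresh (m + 1) + max 0 (min t T)) ((j : ℝ) * E.refresh (m + 1)) y
        (EuclideanSpace.single c (1 : ℝ))) a) a c) y) := by
  simp only [Matrix.of_apply]
  exact continuous_uncurry_iterPartialDeriv_clamp
    (ψ := fun s y => (E.flowDeriv m ((j : ℝ) * E.refresh (m + 1) + s) ((j : ℝ) * E.refresh (m + 1)) y
      (EuclideanSpace.single c (1 : ℝ))) a) hT0
    (fun l' => h.continuousOn_stLift_iterPartialDeriv_flowDeriv_entry m j hT a c l') l

/-- **Entrywise bound, every real time**: `|J̃(t,y)_{ac}| ≤ 1 + C_D` with `C_D` the first-order window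
bound of the displacement. [cite: ArmstrongVicol2025, §5.1 (flow estimates on refresh windows)] -/
theorem LevelRegular.exists_bound_clampFrame_entry (h : E.LevelRegular) (m : ℕ) (j : ℤ)
    {T : ℝ} (hT0 : 0 ≤ T) (hT : T < E.refresh (m + 1)) :
    ∃ B : ℝ, ∀ (t : ℝ) (y : UnitAddTorus (Fin 3)) (a c : Fin 3),
      |(Matrix.of fun a c => (E.flowDeriv m ((j : ℝ) * E.refresh (m + 1) + max 0 (min t T))
        ((j : ℝ) * E.refresh (m + 1)) y (EuclideanSpace.single c (1 : ℝ))) a) a c| ≤ B := by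
  obtain ⟨-, hDs, hDB⟩ := h.window_disp_clauses m j hT
  obtain ⟨CD, hCD⟩ := hDB 1
  refine ⟨1 + CD, fun t y a c => ?_⟩
  have hs := clamp_mem_Icc hT0 t
  rw [Matrix.of_apply, h.flowDeriv_single_apply]
  have h1 : IsContDiff 1 (E.disp m ((j : ℝ) * E.refresh (m + 1) + max 0 (min t T)) ((j : ℝ) * E.refresh (m + 1))) :=
    (hDs _ hs).isContDiff (by simp)
  refine (abs_add_le _ _).trans (add_le_add (by rw [Matrix.one_apply]; split_ifs <;> simp) ?_)
  obtain ⟨v, rfl⟩ := proj_surjective y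
  rw [partialDeriv_apply_coord h1]
  calc |FunctionSpaces.Torus.partialDeriv c (E.disp m ((j : ℝ) * E.refresh (m + 1) + max 0 (min t T)) ((j : ℝ) * E.refresh (m + 1))) (proj v) a|
      ≤ ‖FunctionSpaces.Torus.partialDeriv c (E.disp m ((j : ℝ) * E.refresh (m + 1) + max 0 (min t T)) ((j : ℝ) * E.refresh (m + 1))) (proj v)‖ := by
        rw [← Real.norm_eq_abs]; exact PiLp.norm_apply_le _ a
    _ = ‖_root_.fderiv ℝ (lift (E.disp m ((j : ℝ) * E.refresh (m + 1) + max 0 (min t T)) ((j : ℝ) * E.refresh (m + 1)))) v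
          (EuclideanSpace.single c (1 : ℝ))‖ := by
        rw [← congrFun (lift_lineDeriv h1 (EuclideanSpace.single c (1 : ℝ))) v]; rfl
    _ ≤ ‖_root_.fderiv ℝ (lift (E.disp m ((j : ℝ) * E.refresh (m + 1) + max 0 (min t T)) ((j : ℝ) * E.refresh (m + 1)))) v‖ *
          ‖(EuclideanSpace.single c (1 : ℝ) : EuclideanSpace ℝ (Fin 3))‖ := ContinuousLinearMap.le_opNorm _ _
    _ ≤ CD * 1 := by
        rw [show ‖(EuclideanSpace.single c (1 : ℝ) : EuclideanSpace ℝ (Fin 3))‖ = 1 by simp, ← norm_iteratedFDeriv_one]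
        exact mul_le_mul_of_nonneg_right (hCD _ hs v) zero_le_one
    _ = CD := mul_one CD

/-- **Entrywise Lipschitz on the window**, in the shape consumed by `exists_lipschitz_distort` (FT3).
[cite: ArmstrongVicol2025, §5.1 (flow estimates on refresh windows)] -/
theorem LevelRegular.exists_lipschitz_clampFrame_entry (h : E.LevelRegular) {m : ℕ} (hF : E.IsFlow m) (j : ℤ)
    {T : ℝ} (hT : T < E.refresh (m + 1)) :
    ∃ K : ℝ, ∀ t ∈ Icc 0 T, ∀ s ∈ Icc 0 T, ∀ (y : UnitAddTorus (Fin 3)) (a c : Fin 3),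
      |(Matrix.of fun a c => (E.flowDeriv m ((j : ℝ) * E.refresh (m + 1) + max 0 (min t T))
          ((j : ℝ) * E.refresh (m + 1)) y (EuclideanSpace.single c (1 : ℝ))) a) a c -
        (Matrix.of fun a c => (E.flowDeriv m ((j : ℝ) * E.refresh (m + 1) + max 0 (min s T))
          ((j : ℝ) * E.refresh (m + 1)) y (EuclideanSpace.single c (1 : ℝ))) a) a c| ≤ K * |t - s| := by
  obtain ⟨K, hK⟩ := h.lipschitzOnWith_flowDeriv_entry hF j hT
  refine ⟨K, fun t ht s hs y a c => ?_⟩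
  simp only [Matrix.of_apply, clamp_eq_self ht, clamp_eq_self hs]
  have h1 := (hK y a c).dist_le_mul t ht s hs
  rwa [Real.dist_eq, Real.dist_eq] at h1

/-- **The variational equation for the clamped frame at every interior time** (all entries at once,
as a curve in `Fin 3 → Fin 3 → ℝ`; `Matrix.of` of it is the matrix form `∂ₜJ̃ = ∇b_{≤m}(w+t, X) · J̃`):
for `t ∈ (0,T)` (so for a.e. `t ∈ (0,T)`). [cite: ArmstrongVicol2025, §5.1; DiPernaLions1989Invent, §II.1] -/
theorem LevelRegular.hasDerivAt_clampFrame (h : E.LevelRegular) {m : ℕ} (hF : E.IsFlow m) (j : ℤ)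
    {T : ℝ} (hT : T < E.refresh (m + 1)) {t : ℝ} (ht : t ∈ Ioo 0 T) (y : UnitAddTorus (Fin 3)) :
    HasDerivAt
      (fun t : ℝ => fun a c : Fin 3 => (E.flowDeriv m ((j : ℝ) * E.refresh (m + 1) + max 0 (min t T))
        ((j : ℝ) * E.refresh (m + 1)) y (EuclideanSpace.single c (1 : ℝ))) a)
      (fun a c : Fin 3 =>
        ((Matrix.of fun a i => FunctionSpaces.Torus.partialDeriv i
            (fun z => E.partialSum m ((j : ℝ) * E.refresh (m + 1) + t) z a)
            (E.X m ((j : ℝ) * E.refresh (m + 1) + t) ((j : ℝ) * E.refresh (m + 1)) y)) *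
          (Matrix.of fun a c => (E.flowDeriv m ((j : ℝ) * E.refresh (m + 1) + t) ((j : ℝ) * E.refresh (m + 1)) y
            (EuclideanSpace.single c (1 : ℝ))) a)) a c) t := by
  have htI : t ∈ Icc 0 T := Ioo_subset_Icc_self ht
  -- the unclamped frame has the derivative within `[0,T]`, hence two-sided at the interior time
  have hJ : HasDerivAt
      (fun t : ℝ => fun a c : Fin 3 => (E.flowDeriv m ((j : ℝ) * E.refresh (m + 1) + t)
        ((j : ℝ) * E.refresh (m + 1)) y (EuclideanSpace.single c (1 : ℝ))) a)
      (fun a c : Fin 3 =>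
        ((Matrix.of fun a i => FunctionSpaces.Torus.partialDeriv i
            (fun z => E.partialSum m ((j : ℝ) * E.refresh (m + 1) + t) z a)
            (E.X m ((j : ℝ) * E.refresh (m + 1) + t) ((j : ℝ) * E.refresh (m + 1)) y)) *
          (Matrix.of fun a c => (E.flowDeriv m ((j : ℝ) * E.refresh (m + 1) + t) ((j : ℝ) * E.refresh (m + 1)) y
            (EuclideanSpace.single c (1 : ℝ))) a)) a c) t := by
    refine HasDerivWithinAt.hasDerivAt ?_ (Icc_mem_nhds ht.1 ht.2)
    refine hasDerivWithinAt_pi.2 fun a => hasDerivWithinAt_pi.2 fun c => ?_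
    refine (h.hasDerivWithinAt_flowDeriv_entry hF j hT htI y a c).congr_deriv ?_
    simp only [Matrix.mul_apply, Matrix.of_apply]
  -- the clamped frame agrees with it near `t`
  refine hJ.congr_of_eventuallyEq ?_
  filter_upwards [Icc_mem_nhds ht.1 ht.2] with s hs
  simp only [clamp_eq_self hs]

end LagrangianLatticeCarrier

end Literature.Analysis.FluidPDE.LatticeShear

end
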